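import Literature.Probability.RandomPlanarGeometry.SAWPulledLargeForceThirdOrder
import HarnessLib

/-!
# The pulled walk on `ℤ²`: the tilted finite-memory transfer bound for EVERY memory length, and certificates by evaluation

Topic `Literature/Probability/RandomPlanarGeometry` (continues `SAWPulledLargeForceThirdOrder.lean` — namespace `PullSq`, memory three
written out letter by letter — and `SAWPulledMemoryFiveFramework.lean` — `PullR6`, memory five). Here the memory is a LIST of `M` letters
and the rule is the sharp one: a letter may be appended iff the new site differs from each of the `M + 1` sites the window remembers,
i.e. no non-empty suffix of the window has zero displacement (`PullMem.Allowed`; Madras–Slade's walks with finite memory `τ = M + 1`,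
`c_{N,τ} ≥ c_N`). Every self-avoiding word is admissible after any prefix (`PullMem.adm_of_isSAW`), `M` virtual up-steps in front of a
weak-half-space self-avoiding word keep it self-avoiding (`PullMem.isSAW_replicate_up_append`), and a `Λ`-excessive potential `u ≥ δ > 0` on
the `M`-letter memories bounds Beaton's partition function: **`PullMem.pulledU_le_of_potential`:
`U_n(y) ≤ Λⁿ · u(+e₀,…,+e₀) / δ`**. This is the memory-uniform form of `PullSq.pulledU_le_of_potential3` /
`PullR6.pulledU_le_of_potential5`. Second half (`PullMem.Cert`): CERTIFICATES BY EVALUATION on integer coefficient lists — the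
excessive-potential checker `certOK` with its soundness `pulledFreeEnergy_le_log_of_certOK` (upper bounds `λ(y) ≤ log Λ(y)`), and the
tilted Kraft checker `kraftOK` (a word list certified irreducible by the crossing criterion, `Σ_s y^{a|s|+span} P^{N−|s|} ≥ P^N`) with
`log_le_pulledBridgeFreeEnergy_of_kraftOK` (lower bounds `log(P(y)/y^a) ≤ λ_B(y)`, via `Renewal.exists_mul_pow_le_pulledBridgeZ`). The
tables for a given order live in the files that use them (one `native_decide` each).

References: Madras–Slade 1993 §1.2 (1.2.12)–(1.2.14) (finite-memory walks); Beaton 2015 §2 (`U_n(y)`), Lemma 2, Theorem 1; Kesten 1963 §4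
(irreducible bridges); Jensen 2004 §2.1 (crossing criterion). (Lane «pcv-sawmu», a-p3 g14.)
-/

noncomputable section

open Finset Filter Topology Literature.Probability.LatticeModels
open Literature.Probability.RandomPlanarGeometry.SAW

namespace Literature.Probability.RandomPlanarGeometry.SAW.Zd

namespace PullMem

open PullSq

/-! ## The rule -/

/-- The sliding memory: forget the oldest letter, remember the new one. [folklore] -/
def shift (m : List Step) (s : Step) : List Step := (m ++ [s]).drop 1

/-- `shift` preserves the length. [folklore] -/
@[simp] private theorem length_shift (m : List Step) (s : Step) : (shift m s).length = m.length := by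
  simp [shift]

/-- The finite-memory rule: the letter `s` may follow the remembered letters `m` iff the window `m ++ [s]` is itself a
self-avoiding word (its `|m| + 2` sites are distinct: Madras–Slade's memory `τ = |m| + 1`). [cite: MadrasSlade1993, §1.2, eq. (1.2.12)–(1.2.14)] -/
def Allowed (m : List Step) (s : Step) : Prop := IsSAW (m ++ [s])

/-- `Allowed` is decidable. [folklore] -/
instance (m : List Step) (s : Step) : Decidable (Allowed m s) := by
  unfold Allowed; infer_instance

/-- Admissibility of a word read letter by letter from the memory `m`. [cite: MadrasSlade1993, §1.2, eq. (1.2.12)–(1.2.14)] -/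
def Adm : List Step → List Step → Prop
  | _, [] => True
  | m, s :: w => Allowed m s ∧ Adm (shift m s) w

/-- `Adm` is decidable. [folklore] -/
instance decAdm : ∀ (m w : List Step), Decidable (Adm m w)
  | _, [] => isTrue trivial
  | m, s :: w => by
    unfold Adm
    haveI := decAdm (shift m s) w
    infer_instance

/-! ## Tilted potential sums -/

/-- The tilted value of a word read from the memory `m`: `Π swt · u(final memory)`. [folklore] -/
def pval (u : List Step → ℝ) (y : ℝ) : List Step → List Step → ℝ
  | m, [] => u m
  | m, s :: w => swt y s * pval u y (shift m s) w

/-- `pval` restricted to admissible words. [folklore] -/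
def pF (u : List Step → ℝ) (y : ℝ) (m w : List Step) : ℝ :=
  if Adm m w then pval u y m w else 0

/-- The one-step tilted potential sum of the rule. [folklore] -/
def plocSum (u : List Step → ℝ) (y : ℝ) (m : List Step) : ℝ :=
  ∑ s : Step, if Allowed m s then swt y s * u (shift m s) else 0

/-- `swt > 0` for `y > 0`. [folklore] -/
private theorem swt_pos'' {y : ℝ} (hy : 0 < y) (s : Step) : 0 < swt y s := zpow_pos hy _

/-- `pF (s :: w)` factorises through the first letter. [folklore] -/
private theorem pF_cons (u : List Step → ℝ) (y : ℝ) (m : List Step) (s : Step) (w : List Step) :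
    pF u y m (s :: w) = (if Allowed m s then swt y s else 0) * pF u y (shift m s) w := by
  unfold pF
  by_cases h : Allowed m s
  · by_cases h' : Adm (shift m s) w
    · rw [if_pos (show Adm m (s :: w) from ⟨h, h'⟩), if_pos h, if_pos h', pval]
    · rw [if_neg (show ¬ Adm m (s :: w) from fun hh => h' hh.2), if_neg h', mul_zero]
  · rw [if_neg (show ¬ Adm m (s :: w) from fun hh => h hh.1), if_neg h, zero_mul]

/-- `words (n+1)` as an image of `Step × words n`. [folklore] -/
private theorem words_succ_eq_image (n : ℕ) :
    words (n + 1) = (Finset.univ ×ˢ words n).image (fun p : Step × List Step => p.1 :: p.2) := by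
  ext w
  simp only [mem_words, Finset.mem_image, Finset.mem_product, Finset.mem_univ, true_and]
  constructor
  · intro h
    cases w with
    | nil => simp at h
    | cons s v => exact ⟨(s, v), by simpa using h, rfl⟩
  · rintro ⟨⟨s, v⟩, hv, rfl⟩
    simpa using hv

/-- **The excessive-potential bound** for any memory length: if every one-step sum is `≤ Λ u` on the memories of length `M`, then
`Σ_{|w| = n} pF ≤ Λⁿ u(m)` for every memory `m` of length `M`. [cite: MadrasSlade1993, §1.2, eq. (1.2.12)–(1.2.14)] -/
theorem psum_words_le {M : ℕ} {u : List Step → ℝ} {y Λ : ℝ} (hy : 0 < y) (hΛ : 0 ≤ Λ)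
    (hloc : ∀ m : List Step, m.length = M → plocSum u y m ≤ Λ * u m) :
    ∀ (n : ℕ) (m : List Step), m.length = M → ∑ w ∈ words n, pF u y m w ≤ Λ ^ n * u m := by
  classical
  intro n
  induction n with
  | zero =>
    intro m _
    have h0 : words 0 = {[]} := by
      ext w; simp only [mem_words, Finset.mem_singleton, List.length_eq_zero_iff]
    simp [h0, pF, Adm, pval]
  | succ n ih =>
    intro m hm
    rw [words_succ_eq_image, Finset.sum_image, Finset.sum_product]
    · calc ∑ s : Step, ∑ w ∈ words n, pF u y m (s :: w)
            = ∑ s : Step, (if Allowed m s then swt y s else 0) * ∑ w ∈ words n, pF u y (shift m s) w := by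
              refine Finset.sum_congr rfl fun s _ => ?_
              rw [Finset.mul_sum]
              refine Finset.sum_congr rfl fun w _ => ?_
              rw [pF_cons]
        _ ≤ ∑ s : Step, (if Allowed m s then swt y s else 0) * (Λ ^ n * u (shift m s)) := by
              refine Finset.sum_le_sum fun s _ => ?_
              by_cases hs : Allowed m s
              · rw [if_pos hs]
                exact mul_le_mul_of_nonneg_left (ih (shift m s) (by rw [length_shift, hm])) (swt_pos'' hy s).le
              · rw [if_neg hs, zero_mul, zero_mul]
        _ = Λ ^ n * plocSum u y m := by
              rw [plocSum, Finset.mul_sum]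
              refine Finset.sum_congr rfl fun s _ => ?_
              split_ifs <;> ring
        _ ≤ Λ ^ n * (Λ * u m) := mul_le_mul_of_nonneg_left (hloc m hm) (pow_nonneg hΛ n)
        _ = Λ ^ (n + 1) * u m := by ring
    · rintro ⟨s, w⟩ _ ⟨s', w'⟩ _ hp
      simp only [List.cons.injEq] at hp
      exact Prod.ext hp.1 hp.2

/-! ## The value of an admissible word -/

/-- The memory after reading `w` from `m`. [folklore] -/
def lastMem : List Step → List Step → List Step
  | m, [] => m
  | m, s :: w => lastMem (shift m s) w

/-- `lastMem` preserves the length. [folklore] -/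
@[simp] private theorem length_lastMem : ∀ (m w : List Step), (lastMem m w).length = m.length
  | _, [] => rfl
  | m, s :: w => by rw [lastMem, length_lastMem, length_shift]

/-- The height gained by a word (first coordinate of its displacement) is the sum of the `dx`. [folklore] -/
private theorem wEnd_zero_cons (s : Step) (w : List Step) : wEnd (s :: w) 0 = s.dx + wEnd w 0 := by
  rw [wEnd_cons, Pi.add_apply, Step.vec_apply_zero]

/-- `pval = y^{height gained} · u(final memory)` (`y ≠ 0`). [cite: Beaton2015, §2 (pp. 2–3: the weight y^{h} of U_n(y))] -/
theorem pval_eq (u : List Step → ℝ) {y : ℝ} (hy : y ≠ 0) :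
    ∀ (w m : List Step), pval u y m w = y ^ (wEnd w 0) * u (lastMem m w)
  | [], m => by simp [pval, lastMem]
  | s :: w, m => by
    rw [pval, pval_eq u hy w (shift m s), lastMem, wEnd_zero_cons, zpow_add₀ hy, swt]
    ring

/-! ## Self-avoiding words are admissible -/

/-- A self-avoiding word passes the rule at its letter number `|m| + 1`. [folklore] -/
private theorem allowed_of_isSAW {m : List Step} {s : Step} {w : List Step} (h : IsSAW (m ++ s :: w)) : Allowed m s := by
  have htake : (m ++ s :: w).take (m.length + 1) = m ++ [s] := by
    rw [List.take_append, List.take_of_length_le (by omega), Nat.add_sub_cancel_left]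
    simp
  have := h.take (m.length + 1)
  rwa [htake] at this

/-- Dropping the first letter of `m ++ s :: w` leaves `shift m s ++ w`. [folklore] -/
private theorem shift_append (m : List Step) (s : Step) (w : List Step) : shift m s ++ w = (m ++ s :: w).drop 1 := by
  rw [shift, ← List.drop_append_of_le_length (by simp)]
  simp

/-- **A self-avoiding word is admissible for the finite-memory rule after any prefix**: every window of `m ++ w` is a piece of a
self-avoiding word. [cite: MadrasSlade1993, §1.2, eq. (1.2.12)–(1.2.14)] -/
theorem adm_of_isSAW : ∀ (w m : List Step), IsSAW (m ++ w) → Adm m w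
  | [], _, _ => trivial
  | s :: w, m, h => by
    refine ⟨allowed_of_isSAW h, adm_of_isSAW w (shift m s) ?_⟩
    rw [shift_append]
    exact h.drop 1

/-! ## Virtual up-steps -/

/-- The height of the straight word `[+e₀]^i`. [folklore] -/
private theorem wEnd_replicate_up_zero : ∀ i : ℕ, wEnd (List.replicate i (0 : Step)) 0 = i
  | 0 => by simp
  | i + 1 => by
    rw [List.replicate_succ, wEnd_zero_cons, wEnd_replicate_up_zero i]
    simp [Step.dx]; ring

/-- **`k` virtual up-steps**: if `w` is self-avoiding and stays in `x ≥ 0`, then `[+e₀]^k ++ w` is self-avoiding (the prefix lives in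
`x < k` after the shift, the rest in `x ≥ k`). [cite: Beaton2015, §2 (pp. 2–3: walks in the half-space)] -/
theorem isSAW_replicate_up_append (k : ℕ) {w : List Step} (hs : IsSAW w) (hx : ∀ i ≤ w.length, 0 ≤ traj w i 0) :
    IsSAW (List.replicate k (0 : Step) ++ w) := by
  rw [isSAW_iff_injOn] at hs ⊢
  set u : List Step := List.replicate k (0 : Step) with hu
  have hul : u.length = k := by simp [hu]
  have hux : ∀ i ≤ k, traj u i 0 = i := by
    intro i hi
    rw [traj, hu, List.take_replicate, min_eq_left hi, wEnd_replicate_up_zero]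
  have huE0 : wEnd u 0 = k := by rw [hu, wEnd_replicate_up_zero]
  have hleft : ∀ i, i < k → traj (u ++ w) i 0 = i := fun i hi => by
    rw [traj_append_left u w (by rw [hul]; exact hi.le), hux i hi.le]
  have hright : ∀ j, traj (u ++ w) (k + j) = wEnd u + traj w j := fun j => by
    rw [← hul]; exact traj_append_right u w j
  intro i hi j hj hij
  simp only [Set.mem_setOf_eq, List.length_append, hul] at hi hj
  rcases lt_or_ge i k with hik | hik <;> rcases lt_or_ge j k with hjk | hjk
  · have a := congrFun hij 0
    rw [hleft i hik, hleft j hjk] at a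
    exact_mod_cast a
  · exfalso
    obtain ⟨l, rfl⟩ : ∃ l, j = k + l := ⟨j - k, by omega⟩
    have a := congrFun hij 0
    rw [hleft i hik, hright l, Pi.add_apply, huE0] at a
    have hl := hx l (by omega)
    have : (i : ℤ) < k := by exact_mod_cast hik
    linarith
  · exfalso
    obtain ⟨l, rfl⟩ : ∃ l, i = k + l := ⟨i - k, by omega⟩
    have a := congrFun hij 0
    rw [hleft j hjk, hright l, Pi.add_apply, huE0] at a
    have hl := hx l (by omega)
    have : (j : ℤ) < k := by exact_mod_cast hjk
    linarith
  · obtain ⟨l, rfl⟩ : ∃ l, i = k + l := ⟨i - k, by omega⟩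
    obtain ⟨l', rfl⟩ : ∃ l', j = k + l' := ⟨j - k, by omega⟩
    rw [hright l, hright l', add_right_inj] at hij
    have := hs (show l ≤ w.length by omega) (show l' ≤ w.length by omega) hij
    omega

/-! ## The transfer bound -/

/-- **`U_n(y) ≤ Λⁿ · u([+e₀]^M) / δ`** for every `Λ`-excessive potential `u ≥ δ > 0` on the memories of length `M` (`y > 0`): a
weak-half-space self-avoiding word prefixed by `M` virtual up-steps is self-avoiding, hence admissible for the memory-`M` rule read from
the straight memory, and its tilted value is `y^{height}` times the final potential. [cite: Beaton2015, §2 (pp. 2–3: U_n(y))] -/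
theorem pulledU_le_of_potential (M : ℕ) (u : List Step → ℝ) {y Λ δ : ℝ} (hy : 0 < y) (hΛ : 0 ≤ Λ) (hδ : 0 < δ)
    (hu : ∀ m : List Step, m.length = M → δ ≤ u m)
    (hloc : ∀ m : List Step, m.length = M → plocSum u y m ≤ Λ * u m) (n : ℕ) :
    pulledU 2 n y ≤ Λ ^ n * u (List.replicate M 0) / δ := by
  classical
  set top : List Step := List.replicate M 0 with htop
  have htopl : top.length = M := by simp [htop]
  set good : Finset (List Step) := (sawWords n).filter (fun w => ∀ i ≤ n, 0 ≤ traj w i 0) with hgood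
  have himage : weakHalfSpaceWalks 2 n = good.image traj := by
    ext ω
    simp only [mem_weakHalfSpaceWalks, Finset.mem_image, hgood, Finset.mem_filter, mem_sawWords]
    constructor
    · rintro ⟨hω, hhp⟩
      have hω' : ω ∈ (sawWords n).image traj := by rw [image_traj_sawWords]; exact hω
      obtain ⟨w, hw, rfl⟩ := Finset.mem_image.1 hω'
      exact ⟨w, ⟨mem_sawWords.1 hw, hhp⟩, rfl⟩
    · rintro ⟨w, ⟨⟨hl, hs⟩, hhp⟩, rfl⟩
      exact ⟨traj_mem_saws hl hs, hhp⟩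
  have hmem : ∀ w ∈ good, (w.length = n ∧ IsSAW w) ∧ ∀ i ≤ n, 0 ≤ traj w i 0 := fun w hw => by
    simpa [hgood] using hw
  have hinj : Set.InjOn traj (good : Set (List Step)) := fun w hw w' hw' h =>
    traj_injOn n (by simp [(hmem w hw).1.1]) (by simp [(hmem w' hw').1.1]) h
  rw [pulledU, himage, Finset.sum_image hinj]
  have hterm : ∀ w ∈ good, y ^ (traj w n 0).toNat ≤ pF u y top w / δ := by
    intro w hw
    obtain ⟨⟨hl, hs⟩, hhp⟩ := hmem w hw
    have hsaw : IsSAW (top ++ w) := isSAW_replicate_up_append M hs (by rw [hl]; exact hhp)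
    have hadm : Adm top w := adm_of_isSAW w top hsaw
    have hend : 0 ≤ wEnd w 0 := by
      have := hhp n le_rfl
      rwa [← hl, traj_length] at this
    have htn : traj w n 0 = wEnd w 0 := by rw [← hl, traj_length]
    rw [pF, if_pos hadm, pval_eq u hy.ne', le_div_iff₀ hδ, htn]
    have hz : y ^ (wEnd w 0).toNat = y ^ (wEnd w 0) := by
      rw [← zpow_natCast, Int.toNat_of_nonneg hend]
    rw [hz]
    exact mul_le_mul_of_nonneg_left (hu _ (by rw [length_lastMem, htopl])) (zpow_pos hy _).le
  have hu0 : ∀ m : List Step, m.length = M → 0 ≤ u m := fun m hm => hδ.le.trans (hu m hm)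
  have hpF0 : ∀ w : List Step, 0 ≤ pF u y top w := by
    intro w
    unfold pF
    split_ifs
    · rw [pval_eq u hy.ne']
      exact mul_nonneg (zpow_pos hy _).le (hu0 _ (by rw [length_lastMem, htopl]))
    · exact le_rfl
  have hsub : good ⊆ words n := fun w hw => mem_words.2 (hmem w hw).1.1
  calc ∑ w ∈ good, y ^ (traj w n 0).toNat ≤ ∑ w ∈ good, pF u y top w / δ := Finset.sum_le_sum hterm
    _ ≤ ∑ w ∈ words n, pF u y top w / δ :=
        Finset.sum_le_sum_of_subset_of_nonneg hsub fun w _ _ => div_nonneg (hpF0 w) hδ.le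
    _ = (∑ w ∈ words n, pF u y top w) / δ := by rw [Finset.sum_div]
    _ ≤ Λ ^ n * u top / δ := by
        gcongr
        exact psum_words_le hy hΛ hloc n top htopl

/-! ## From an excessive potential to the free energy -/

/-- **`λ(y) = max(log μ, λ_B(y)) ≤ log Λ`** whenever a `Λ`-excessive memory-`M` potential with a positive floor exists (`y > 0`, `Λ > 0`):
Beaton's free energy is the growth rate of `U_n(y)`. [cite: Beaton2015, Theorem 1] [cite: MadrasSlade1993, §1.2, eq. (1.2.12)–(1.2.14)] -/
theorem pulledFreeEnergy_le_log_of_potential (M : ℕ) (u : List Step → ℝ) {y Λ δ : ℝ} (hy : 0 < y) (hΛ : 0 < Λ) (hδ : 0 < δ)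
    (hu : ∀ m : List Step, m.length = M → δ ≤ u m)
    (hloc : ∀ m : List Step, m.length = M → plocSum u y m ≤ Λ * u m) :
    max (Real.log (connectiveConstant 2)) (pulledBridgeFreeEnergy 2 y) ≤ Real.log Λ := by
  set c : ℝ := u (List.replicate M 0) / δ with hc
  have hc0 : 0 < c := div_pos (hδ.trans_le (hu _ (by simp))) hδ
  have hU := Beaton2015_freeEnergy 0 hy
  have hb : Tendsto (fun n : ℕ => Real.log (Λ ^ n * c) / n) atTop (𝓝 (Real.log Λ)) := by
    have h1 : Tendsto (fun n : ℕ => Real.log c / n) atTop (𝓝 0) :=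
      tendsto_const_nhds.div_atTop tendsto_natCast_atTop_atTop
    have h2 := h1.const_add (Real.log Λ)
    rw [add_zero] at h2
    refine h2.congr' ?_
    filter_upwards [eventually_gt_atTop 0] with n hn
    have hn' : (n : ℝ) ≠ 0 := by exact_mod_cast hn.ne'
    rw [Real.log_mul (pow_pos hΛ n).ne' hc0.ne', Real.log_pow, add_div, mul_div_cancel_left₀ _ hn']
  refine le_of_tendsto_of_tendsto' hU hb fun n => ?_
  rcases Nat.eq_zero_or_pos n with rfl | hn
  · simp
  have hUpos : 0 < pulledU 2 n y := lt_of_lt_of_le (pulledBridgeZ_pos 1 n hy) (pulledBridgeZ_le_pulledU n hy.le)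
  have hb' : pulledU 2 n y ≤ Λ ^ n * c := by
    rw [hc, ← mul_div_assoc]; exact pulledU_le_of_potential M u hy hΛ.le hδ hu hloc n
  exact div_le_div_of_nonneg_right (Real.log_le_log hUpos hb') (Nat.cast_nonneg n)

/-! ## Certificates by polynomial evaluation

An excessive potential for a given memory length is a finite table of rational functions of `y`; the inequalities it must satisfy are
polynomial in `y` and hold for `y ≥ y₀` as soon as the polynomials have non-negative coefficients in `y − y₀`. The checker below works on
integer coefficient lists (`[c₀, c₁, …] ↦ Σ cᵢ yⁱ`) and is meant to be run by evaluation on explicit tables; its soundness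
(`PullMem.pulledFreeEnergy_le_log_of_certOK`) is proved once here for every memory length. -/

namespace Cert

/-- `[c₀, c₁, …] ↦ c₀ + c₁ y + c₂ y² + …`. [folklore] -/
def evalP : List ℤ → ℝ → ℝ
  | [], _ => 0
  | c :: p, y => c + y * evalP p y

/-- `evalP [] = 0`. [folklore] -/
@[simp] private theorem evalP_nil (y : ℝ) : evalP [] y = 0 := rfl

/-- Horner step. [folklore] -/
@[simp] private theorem evalP_cons (c : ℤ) (p : List ℤ) (y : ℝ) : evalP (c :: p) y = c + y * evalP p y := rfl

/-- Sum of coefficient lists. [folklore] -/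
def addP : List ℤ → List ℤ → List ℤ
  | [], q => q
  | p, [] => p
  | a :: p, b :: q => (a + b) :: addP p q

/-- `evalP` is additive. [folklore] -/
private theorem evalP_addP : ∀ (p q : List ℤ) (y : ℝ), evalP (addP p q) y = evalP p y + evalP q y
  | [], q, y => by simp [addP]
  | a :: p, [], y => by simp [addP]
  | a :: p, b :: q, y => by
    rw [addP, evalP_cons, evalP_cons, evalP_cons, evalP_addP p q y]
    push_cast; ring

/-- Scalar multiple of a coefficient list. [folklore] -/
def smulP (c : ℤ) (p : List ℤ) : List ℤ := p.map (c * ·)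

/-- `evalP` commutes with scalars. [folklore] -/
private theorem evalP_smulP (c : ℤ) : ∀ (p : List ℤ) (y : ℝ), evalP (smulP c p) y = c * evalP p y
  | [], y => by simp [smulP]
  | a :: p, y => by
    have := evalP_smulP c p y
    simp only [smulP, List.map_cons] at this ⊢
    rw [evalP_cons, evalP_cons, this]
    push_cast; ring

/-- Product of coefficient lists. [folklore] -/
def mulP : List ℤ → List ℤ → List ℤ
  | [], _ => []
  | a :: p, q => addP (smulP a q) (0 :: mulP p q)

/-- `evalP` is multiplicative. [folklore] -/
private theorem evalP_mulP : ∀ (p q : List ℤ) (y : ℝ), evalP (mulP p q) y = evalP p y * evalP q y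
  | [], q, y => by simp [mulP]
  | a :: p, q, y => by
    rw [mulP, evalP_addP, evalP_smulP, evalP_cons, evalP_cons, evalP_mulP p q y]
    push_cast; ring

/-- Difference of coefficient lists. [folklore] -/
def subP (p q : List ℤ) : List ℤ := addP p (smulP (-1) q)

/-- `evalP` of a difference. [folklore] -/
private theorem evalP_subP (p q : List ℤ) (y : ℝ) : evalP (subP p q) y = evalP p y - evalP q y := by
  rw [subP, evalP_addP, evalP_smulP]; push_cast; ring

/-- Multiplication by `y^k`. [folklore] -/
def powXP (k : ℕ) (p : List ℤ) : List ℤ := List.replicate k 0 ++ p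

/-- `evalP (y^k · p)`. [folklore] -/
private theorem evalP_powXP (p : List ℤ) (y : ℝ) : ∀ k : ℕ, evalP (powXP k p) y = y ^ k * evalP p y
  | 0 => by simp [powXP]
  | k + 1 => by
    have := evalP_powXP p y k
    rw [powXP] at this
    rw [powXP, List.replicate_succ, List.cons_append, evalP_cons, this]
    push_cast; ring

/-- The shift `p(a + ·)`. [folklore] -/
def shiftP (a : ℤ) : List ℤ → List ℤ
  | [] => []
  | c :: p => addP [c] (mulP [a, 1] (shiftP a p))

/-- `evalP` of the shift. [folklore] -/
private theorem evalP_shiftP (a : ℤ) (y : ℝ) : ∀ p : List ℤ, evalP (shiftP a p) y = evalP p (a + y)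
  | [] => by simp [shiftP]
  | c :: p => by
    rw [shiftP, evalP_addP, evalP_mulP, evalP_shiftP a y p, evalP_cons]
    simp

/-- All coefficients non-negative. [folklore] -/
def nonnegP (p : List ℤ) : Bool := p.all fun c => decide (0 ≤ c)

/-- Non-negative coefficients give a non-negative value on `y ≥ 0`. [folklore] -/
private theorem evalP_nonneg_of_nonnegP : ∀ {p : List ℤ}, nonnegP p = true → ∀ {y : ℝ}, 0 ≤ y → 0 ≤ evalP p y
  | [], _, y, _ => by simp
  | c :: p, h, y, hy => by
    simp only [nonnegP, List.all_cons, Bool.and_eq_true, decide_eq_true_eq] at h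
    rw [evalP_cons]
    have : 0 ≤ evalP p y := evalP_nonneg_of_nonnegP (by simpa [nonnegP] using h.2) hy
    have hc : (0 : ℝ) ≤ c := by exact_mod_cast h.1
    positivity

/-- Certificate for `p(y) ≥ 0` on `y ≥ a`: non-negative coefficients in `y − a`. [folklore] -/
def geCert (a : ℕ) (p : List ℤ) : Bool := nonnegP (shiftP a p)

/-- Soundness of `geCert`. [folklore] -/
private theorem evalP_nonneg_of_geCert {a : ℕ} {p : List ℤ} (h : geCert a p = true) {y : ℝ} (hy : (a : ℝ) ≤ y) : 0 ≤ evalP p y := by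
  have := evalP_nonneg_of_nonnegP h (sub_nonneg.2 hy)
  rw [evalP_shiftP] at this
  simpa using this

/-! ### The row checker -/

/-- All step words of a given length. [folklore] -/
def allWords : ℕ → List (List Step)
  | 0 => [[]]
  | n + 1 => (allWords n).flatMap fun w => [(0 : Step) :: w, 1 :: w, 2 :: w, 3 :: w]

/-- `allWords n` lists every word of length `n`. [folklore] -/
private theorem mem_allWords : ∀ w : List Step, w ∈ allWords w.length
  | [] => by simp [allWords]
  | s :: w => by
    rw [List.length_cons, allWords, List.mem_flatMap]
    refine ⟨w, mem_allWords w, ?_⟩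
    fin_cases s <;> simp

/-- The tilted step weight times `y`, as a polynomial: `y²` for `+e₀`, `1` for `−e₀`, `y` sideways. [folklore] -/
def wP (s : Step) : List ℤ := if s = 0 then [0, 0, 1] else if s = 2 then [1] else [0, 1]

/-- `wP` evaluates to the tilted weight times `y`. [folklore] -/
private theorem evalP_wP {y : ℝ} (hy : y ≠ 0) (s : Step) : evalP (wP s) y = swt y s * y := by
  unfold wP swt
  fin_cases s <;> simp [Step.dx, inv_mul_cancel₀ hy]

/-- The term of the letter `s` in the row of the memory `m` (times `y^{K+E+1}`). [folklore] -/
def termP (E : ℕ) (tab : List Step → List ℤ) (m : List Step) (s : Step) : List ℤ :=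
  if Allowed m s then powXP E (mulP (wP s) (tab (shift m s))) else []

/-- The row polynomial of the memory `m`: `y · (Λ y^E) · T(m) − Σ_s [allowed] (swt·y) · T(m_s) · y^E`. [folklore] -/
def rowP (E : ℕ) (tab : List Step → List ℤ) (lamP : List ℤ) (m : List Step) : List ℤ :=
  subP (mulP (mulP lamP (tab m)) [0, 1])
    (addP (addP (addP (termP E tab m 0) (termP E tab m 1)) (termP E tab m 2)) (termP E tab m 3))

/-- **The certificate checker** for a memory-`M` table `tab` (numerators of `y^K ·` potential), growth polynomial `lamP` (`= Λ · y^E`)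
and threshold `y₀`: `Λ y^E ≥ 1`, every row and every floor `T(m) ≥ 1` hold coefficientwise in `y − y₀`. [folklore] -/
def certOK (M E y0 : ℕ) (tab : List Step → List ℤ) (lamP : List ℤ) : Bool :=
  geCert y0 (subP lamP [1]) &&
    (allWords M).all fun m => geCert y0 (rowP E tab lamP m) && geCert y0 (subP (tab m) [1])

/-- The potential encoded by a table: `u(m) = T(m)(y) / y^K`. [folklore] -/
def pot (K : ℕ) (tab : List Step → List ℤ) (y : ℝ) (m : List Step) : ℝ := evalP (tab m) y / y ^ K

/-- Value of a row term. [folklore] -/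
private theorem evalP_termP {E : ℕ} (tab : List Step → List ℤ) (m : List Step) (s : Step) {y : ℝ} (hy : y ≠ 0) (K : ℕ) :
    evalP (termP E tab m s) y =
      (if Allowed m s then swt y s * pot K tab y (shift m s) else 0) * y ^ K * y ^ E * y := by
  unfold termP pot
  split_ifs with h
  · rw [evalP_powXP, evalP_mulP, evalP_wP hy]
    field_simp
  · simp

/-- **Soundness of the checker**: a passing certificate yields a `Λ`-excessive potential with floor `y^{−K}`, `Λ = lamP(y)/y^E ≥ y^{−E}`. [cite: MadrasSlade1993, §1.2, eq. (1.2.12)–(1.2.14)] -/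
theorem bounds_of_certOK {M K E y0 : ℕ} {tab : List Step → List ℤ} {lamP : List ℤ}
    (h : certOK M E y0 tab lamP = true) {y : ℝ} (hy0 : 1 ≤ y0) (hy : (y0 : ℝ) ≤ y) :
    (1 ≤ evalP lamP y) ∧
    (∀ m : List Step, m.length = M → 1 / y ^ K ≤ pot K tab y m) ∧
    (∀ m : List Step, m.length = M → plocSum (pot K tab y) y m ≤ (evalP lamP y / y ^ E) * pot K tab y m) := by
  have hy1 : (1 : ℝ) ≤ y := le_trans (by exact_mod_cast hy0) hy
  have hypos : 0 < y := by linarith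
  simp only [certOK, Bool.and_eq_true, List.all_eq_true] at h
  obtain ⟨hlam, hrows⟩ := h
  refine ⟨?_, ?_, ?_⟩
  · have := evalP_nonneg_of_geCert hlam hy
    rw [evalP_subP] at this
    simpa [evalP] using this
  · intro m hm
    have hmw := (hrows m (hm ▸ mem_allWords m)).2
    have := evalP_nonneg_of_geCert hmw hy
    rw [evalP_subP] at this
    have h1 : 1 ≤ evalP (tab m) y := by simpa [evalP] using this
    unfold pot
    exact div_le_div_of_nonneg_right h1 (pow_pos hypos K).le
  · intro m hm
    have hmw := (hrows m (hm ▸ mem_allWords m)).1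
    have hN := evalP_nonneg_of_geCert hmw hy
    rw [rowP, evalP_subP, evalP_mulP, evalP_mulP, evalP_addP, evalP_addP, evalP_addP,
      evalP_termP tab m 0 hypos.ne' K, evalP_termP tab m 1 hypos.ne' K, evalP_termP tab m 2 hypos.ne' K,
      evalP_termP tab m 3 hypos.ne' K] at hN
    have hsum : plocSum (pot K tab y) y m =
        (if Allowed m 0 then swt y 0 * pot K tab y (shift m 0) else 0) +
        (if Allowed m 1 then swt y 1 * pot K tab y (shift m 1) else 0) +
        (if Allowed m 2 then swt y 2 * pot K tab y (shift m 2) else 0) +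
        (if Allowed m 3 then swt y 3 * pot K tab y (shift m 3) else 0) := by
      rw [plocSum, Fin.sum_univ_four]
    have hTm : evalP (tab m) y = pot K tab y m * y ^ K := by
      unfold pot; field_simp
    rw [hTm] at hN
    have hev : evalP [0, 1] y = y := by simp [evalP]
    rw [hev] at hN
    rw [hsum]
    -- divide the polynomial inequality by `y^K · y^E · y > 0`
    have hpos : 0 < y ^ K * y ^ E * y := by positivity
    rw [div_mul_eq_mul_div, le_div_iff₀ (pow_pos hypos E)]
    nlinarith [hN, hpos, pow_pos hypos K, pow_pos hypos E]

/-- **From a passing certificate to the free energy**: `λ(y) = max(log μ, λ_B(y)) ≤ log(lamP(y)/y^E)` for `y ≥ y₀`, and the finite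
bound `U_n(y) ≤ (lamP(y)/y^E)ⁿ · T([+e₀]^M)(y)`. [cite: Beaton2015, Theorem 1] [cite: MadrasSlade1993, §1.2, eq. (1.2.12)–(1.2.14)] -/
theorem pulledFreeEnergy_le_log_of_certOK {M K E y0 : ℕ} {tab : List Step → List ℤ} {lamP : List ℤ}
    (h : certOK M E y0 tab lamP = true) (hy0 : 1 ≤ y0) {y : ℝ} (hy : (y0 : ℝ) ≤ y) :
    max (Real.log (connectiveConstant 2)) (pulledBridgeFreeEnergy 2 y) ≤ Real.log (evalP lamP y / y ^ E) ∧
      ∀ n : ℕ, pulledU 2 n y ≤ (evalP lamP y / y ^ E) ^ n * evalP (tab (List.replicate M 0)) y := by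
  have hy1 : (1 : ℝ) ≤ y := le_trans (by exact_mod_cast hy0) hy
  have hypos : 0 < y := by linarith
  obtain ⟨hlam, hfloor, hloc⟩ := bounds_of_certOK (K := K) h hy0 hy
  have hΛ : 0 < evalP lamP y / y ^ E := div_pos (by linarith) (pow_pos hypos E)
  have hδ : (0 : ℝ) < 1 / y ^ K := by positivity
  refine ⟨pulledFreeEnergy_le_log_of_potential M (pot K tab y) hypos hΛ hδ hfloor hloc, fun n => ?_⟩
  have := pulledU_le_of_potential M (pot K tab y) hypos hΛ.le hδ hfloor hloc n
  rw [pot] at this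
  convert this using 1
  field_simp

/-! ## Kraft certificates by evaluation (lower bounds for `λ_B`)

A finite admissible family `S` of irreducible bridges with tilted Kraft sum `Σ_{s ∈ S} x^{|s|} y^{span s} ≥ 1` forces `log(1/x) ≤ λ_B(y)`
(`Renewal.exists_mul_pow_le_pulledBridgeZ`, Kesten's renewal structure). With `x = y^a / P(y)` for an integer polynomial `P ≥ 1` the
Kraft inequality is polynomial — `Σ_s y^{a|s| + span s} · P^{N − |s|} ≥ P^N` for any `N ≥ max |s|` — and is checked coefficientwise in
`y − y₀`; irreducibility of each word is the decidable crossing criterion (`isIrreducible_of_crossings`). -/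

/-- Decidable certificate that a step word is an irreducible bridge: self-avoiding, span `≥ 1`, the bridge inequalities
`0 < x_i ≤ x_n`, and no internal column gap `{k, k+1}` (`1 ≤ k < span`) crossed exactly once. [cite: Jensen2004SAWLowerBounds, §2.1] [cite: Kesten1963SAW, §4] -/
def IrrCert (s : List Step) : Prop :=
  IsSAW s ∧ 1 ≤ xEnd s ∧ (∀ i < s.length + 1, 1 ≤ i → 0 < xAt s i ∧ xAt s i ≤ xEnd s) ∧
    ∀ k < (xEnd s).toNat, 1 ≤ k → crossings s k ≠ 1

/-- `IrrCert` is decidable. [folklore] -/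
instance (s : List Step) : Decidable (IrrCert s) := by
  unfold IrrCert; infer_instance

/-- **A certified word is an irreducible bridge.** [cite: Jensen2004SAWLowerBounds, §2.1] [cite: Kesten1963SAW, §4] -/
theorem isIrrBridge_of_irrCert {s : List Step} (h : IrrCert s) : IsIrrBridge s := by
  obtain ⟨hsaw, hpos, hb, hcr⟩ := h
  have hbr : IsBridgeW s := (isBridgeW_iff s).2 fun i h1 h2 => hb i (Nat.lt_succ_of_le h2) h1
  refine ⟨hsaw, hbr, isIrreducible_of_crossings hbr fun k h1 h2 => ?_, ?_⟩
  · have hk : k = ((k.toNat : ℕ) : ℤ) := (Int.toNat_of_nonneg (by omega)).symm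
    rw [hk]
    exact hcr k.toNat (by omega) (by omega)
  · rintro rfl
    simp [xEnd, xAt] at hpos

/-- `P^n` as a coefficient list. [folklore] -/
def powP (P : List ℤ) : ℕ → List ℤ
  | 0 => [1]
  | n + 1 => mulP P (powP P n)

/-- `evalP (P^n) = (evalP P)^n`. [folklore] -/
private theorem evalP_powP (P : List ℤ) (y : ℝ) : ∀ n : ℕ, evalP (powP P n) y = evalP P y ^ n
  | 0 => by simp [powP]
  | n + 1 => by rw [powP, evalP_mulP, evalP_powP P y n, pow_succ]; ring

/-- The Kraft polynomial `Σ_s y^{a|s| + span s} · P^{N − |s|}` of a word list. [cite: Kesten1963SAW, §4] -/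
def kraftSumP (a N : ℕ) (P : List ℤ) : List (List Step) → List ℤ
  | [] => []
  | s :: fam => addP (powXP (a * s.length + (xEnd s).toNat) (powP P (N - s.length))) (kraftSumP a N P fam)

/-- Value of the Kraft polynomial. [folklore] -/
private theorem evalP_kraftSumP (a N : ℕ) (P : List ℤ) (y : ℝ) : ∀ fam : List (List Step),
    evalP (kraftSumP a N P fam) y =
      (fam.map fun s => y ^ (a * s.length + (xEnd s).toNat) * evalP P y ^ (N - s.length)).sum
  | [] => by simp [kraftSumP]
  | s :: fam => by
    rw [kraftSumP, evalP_addP, evalP_powXP, evalP_powP, evalP_kraftSumP a N P y fam, List.map_cons, List.sum_cons]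

/-- **The Kraft certificate checker**: every word certified irreducible, the up-step present, no repetitions, lengths `≤ N`,
`P ≥ 1` and `Σ_s y^{a|s| + span s} P^{N − |s|} − P^N ≥ 0` coefficientwise in `y − y₀`. [cite: Kesten1963SAW, §4] -/
def kraftOK (a N y0 : ℕ) (fam : List (List Step)) (P : List ℤ) : Bool :=
  (fam.all fun s => decide (IrrCert s)) && decide ([(0 : Step)] ∈ fam) && decide fam.Nodup &&
    (fam.all fun s => decide (s.length ≤ N)) && geCert y0 (subP P [1]) &&
      geCert y0 (subP (kraftSumP a N P fam) (powP P N))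

/-- **From a passing Kraft certificate to the free energy**: `log(P(y)/y^a) ≤ λ_B(y)` for every `y ≥ y₀` (the family's tilted Kraft sum is
`≥ 1` at `x = y^a/P(y)`, so bridges built from the family grow at least like `(P/y^a)^N`). [cite: Beaton2015, Lemma 2] [cite: Kesten1963SAW, §4] -/
theorem log_le_pulledBridgeFreeEnergy_of_kraftOK {a N y0 : ℕ} {fam : List (List Step)} {P : List ℤ}
    (h : kraftOK a N y0 fam P = true) (hy0 : 1 ≤ y0) {y : ℝ} (hy : (y0 : ℝ) ≤ y) :
    Real.log (evalP P y / y ^ a) ≤ pulledBridgeFreeEnergy 2 y := by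
  classical
  simp only [kraftOK, Bool.and_eq_true, List.all_eq_true, decide_eq_true_eq] at h
  obtain ⟨⟨⟨⟨⟨hirr, hE⟩, hnd⟩, hlen⟩, hP1⟩, hK⟩ := h
  have hy1 : (1 : ℝ) ≤ y := le_trans (by exact_mod_cast hy0) hy
  have hypos : 0 < y := by linarith
  have hPge : 1 ≤ evalP P y := by
    have := evalP_nonneg_of_geCert hP1 hy
    rw [evalP_subP] at this
    simpa [evalP] using this
  have hPpos : 0 < evalP P y := by linarith
  set S : Finset (List Step) := fam.toFinset with hSdef
  have hS : Renewal.Admissible S := fun s hs => isIrrBridge_of_irrCert (hirr s (List.mem_toFinset.1 hs))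
  have hES : [(0 : Step)] ∈ S := List.mem_toFinset.2 hE
  set x : ℝ := y ^ a / evalP P y with hxdef
  have hx : 0 < x := div_pos (pow_pos hypos a) hPpos
  have hsum : 0 ≤ (fam.map fun s => y ^ (a * s.length + (xEnd s).toNat) * evalP P y ^ (N - s.length)).sum
      - evalP P y ^ N := by
    have := evalP_nonneg_of_geCert hK hy
    rwa [evalP_subP, evalP_kraftSumP, evalP_powP] at this
  have key : ∀ s ∈ S, x ^ s.length * y ^ (xEnd s).toNat =
      y ^ (a * s.length + (xEnd s).toNat) * evalP P y ^ (N - s.length) / evalP P y ^ N := by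
    intro s hs
    have hn : s.length ≤ N := hlen s (List.mem_toFinset.1 hs)
    have hsplit : evalP P y ^ N = evalP P y ^ s.length * evalP P y ^ (N - s.length) := by
      rw [← pow_add, Nat.add_sub_cancel' hn]
    rw [hsplit, hxdef, div_pow, ← pow_mul, pow_add]
    field_simp
  have hK' : (1 : ℝ) ≤ ∑ s ∈ S, x ^ s.length * y ^ (xEnd s).toNat := by
    rw [Finset.sum_congr rfl key, ← Finset.sum_div, le_div_iff₀ (pow_pos hPpos N), one_mul, hSdef,
      List.sum_toFinset _ hnd]
    linarith
  obtain ⟨κ, hκ, hgeo⟩ := Renewal.exists_mul_pow_le_pulledBridgeZ hS hES hx hypos hK'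
  have hxinv : x⁻¹ = evalP P y / y ^ a := by rw [hxdef, inv_div]
  rw [hxinv] at hgeo
  exact log_le_pulledBridgeFreeEnergy_of_geometric 1 hypos hκ (div_pos hPpos (pow_pos hypos a)) hgeo

/-! ### Text tables

The certificate tables of the order files are stored as text (one string literal) and parsed by the functions below; the soundness
theorems above hold for ANY table function, so nothing about the parsers needs proof. -/

/-- Parse a space-separated row of integers. [folklore] -/
def parseInts (s : String) : List ℤ := ((s.splitOn " ").filter (· ≠ "")).filterMap String.toInt?

/-- Parse a space-separated row of naturals. [folklore] -/
def parseNats (s : String) : List ℕ := ((s.splitOn " ").filter (· ≠ "")).filterMap String.toNat?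

/-- Pair up a flat list. [folklore] -/
def pairUp : List ℕ → List (ℕ × ℕ)
  | a :: b :: l => (a, b) :: pairUp l
  | _ => []

/-- Parse a digit string into a step word (`'0' ↦ +e₀, '1' ↦ +e₁, '2' ↦ −e₀, '3' ↦ −e₁`). [folklore] -/
def parseWord (s : String) : List Step :=
  s.toList.filterMap fun c => if c = '0' then some 0 else if c = '1' then some 1 else if c = '2' then some 2
    else if c = '3' then some 3 else none

/-- Base-4 code of a window (first letter most significant). [folklore] -/
def wcode (m : List Step) : ℕ := m.foldl (fun c s => 4 * c + (s : ℕ)) 0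

/-- Parse the `|`-separated numerator rows of a table. [folklore] -/
def parsePots (potsStr : String) : List (List ℤ) := (potsStr.splitOn "|").map parseInts

/-- Parse the flat `code index` list of a table. [folklore] -/
def parseIdx (idxStr : String) : List (ℕ × ℕ) := pairUp (parseNats idxStr)

/-- Table lookup: the numerator of the window `m` (by base-4 code), or `dflt` for unlisted windows. (Keep the parsed lists in
argument-free top-level definitions so that they are evaluated once.) [folklore] -/
def lookupTable (pots : List (List ℤ)) (idx : List (ℕ × ℕ)) (dflt : List ℤ) (m : List Step) : List ℤ :=
  match idx.lookup (wcode m) with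
  | some i => pots.getD i [1]
  | none => dflt

/-- A word family given as space-separated digit words. [folklore] -/
def familyOf (famStr : String) : List (List Step) := ((famStr.splitOn " ").filter (· ≠ "")).map parseWord

/-! ### A faster checker: skip the words with an immediate reversal

`certOK` visits all `4^M` words and decides `IsSAW` four times for each; for `M ≥ 9` that exceeds a farm node's budget in the
interpreter. Most words contain an immediate reversal `s, −s`, are therefore not self-avoiding, admit no letter, and have the trivial
row; `certOKFast` detects them by one pass over adjacent letters and checks the row only for the others (`4·3^{M−1}` words). -/

/-- The word has two consecutive opposite letters. [folklore] -/
def hasRev : List Step → Bool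
  | a :: b :: w => decide (Step.vec a + Step.vec b = 0) || hasRev (b :: w)
  | _ => false

/-- A word with an immediate reversal is not self-avoiding (the site before the reversal is revisited). [folklore] -/
private theorem not_isSAW_of_hasRev : ∀ {w : List Step}, hasRev w = true → ¬ IsSAW w
  | [], h, _ => by simp [hasRev] at h
  | [a], h, _ => by simp [hasRev] at h
  | a :: b :: w, h, hs => by
    simp only [hasRev, Bool.or_eq_true, decide_eq_true_eq] at h
    rcases h with h | h
    · rw [isSAW_iff_injOn] at hs
      have h0 : traj (a :: b :: w) 0 = traj (a :: b :: w) 2 := by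
        simp [traj, wEnd, h]
      have := hs (show 0 ∈ {i | i ≤ (a :: b :: w).length} by simp) (show 2 ∈ {i | i ≤ (a :: b :: w).length} by simp) h0
      omega
    · exact not_isSAW_of_hasRev h (hs.drop 1)

/-- **The fast certificate checker**: as `certOK`, but the row of a word with an immediate reversal is not computed (it is trivial).
[cite: MadrasSlade1993, §1.2, eq. (1.2.12)–(1.2.14)] -/
def certOKFast (M E y0 : ℕ) (tab : List Step → List ℤ) (lamP : List ℤ) : Bool :=
  geCert y0 (subP lamP [1]) &&
    (allWords M).all fun m => geCert y0 (subP (tab m) [1]) && (hasRev m || geCert y0 (rowP E tab lamP m))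

/-- **Soundness of the fast checker** (same conclusions as `bounds_of_certOK`). [cite: MadrasSlade1993, §1.2, eq. (1.2.12)–(1.2.14)] -/
theorem bounds_of_certOKFast {M K E y0 : ℕ} {tab : List Step → List ℤ} {lamP : List ℤ}
    (h : certOKFast M E y0 tab lamP = true) {y : ℝ} (hy0 : 1 ≤ y0) (hy : (y0 : ℝ) ≤ y) :
    (1 ≤ evalP lamP y) ∧
    (∀ m : List Step, m.length = M → 1 / y ^ K ≤ pot K tab y m) ∧
    (∀ m : List Step, m.length = M → plocSum (pot K tab y) y m ≤ (evalP lamP y / y ^ E) * pot K tab y m) := by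
  have hy1 : (1 : ℝ) ≤ y := le_trans (by exact_mod_cast hy0) hy
  have hypos : 0 < y := by linarith
  simp only [certOKFast, Bool.and_eq_true, List.all_eq_true, Bool.or_eq_true] at h
  obtain ⟨hlam, hrows⟩ := h
  have hlam1 : 1 ≤ evalP lamP y := by
    have := evalP_nonneg_of_geCert hlam hy
    rw [evalP_subP] at this
    simpa [evalP] using this
  have hfloor : ∀ m : List Step, m.length = M → 1 / y ^ K ≤ pot K tab y m := by
    intro m hm
    have hmw := (hrows m (hm ▸ mem_allWords m)).1
    have := evalP_nonneg_of_geCert hmw hy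
    rw [evalP_subP] at this
    have h1 : 1 ≤ evalP (tab m) y := by simpa [evalP] using this
    unfold pot
    exact div_le_div_of_nonneg_right h1 (pow_pos hypos K).le
  refine ⟨hlam1, hfloor, ?_⟩
  intro m hm
  rcases (hrows m (hm ▸ mem_allWords m)).2 with hrev | hrow
  · -- no letter is allowed after a word with a reversal: the row is `0 ≤ Λ u`
    have hnone : ∀ s : Step, ¬ Allowed m s := fun s hs => by
      have hs' : IsSAW (m ++ [s]) := hs
      have hm' := hs'.take m.length
      rw [List.take_left] at hm'
      exact not_isSAW_of_hasRev hrev hm'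
    have h0 : plocSum (pot K tab y) y m = 0 := by
      rw [plocSum]; exact Finset.sum_eq_zero fun s _ => if_neg (hnone s)
    rw [h0]
    have hu : 0 ≤ pot K tab y m := le_trans (by positivity) (hfloor m hm)
    exact mul_nonneg (div_nonneg (by linarith) (pow_pos hypos E).le) hu
  · -- the row inequality, exactly as in `bounds_of_certOK`
    have hN := evalP_nonneg_of_geCert hrow hy
    rw [rowP, evalP_subP, evalP_mulP, evalP_mulP, evalP_addP, evalP_addP, evalP_addP,
      evalP_termP tab m 0 hypos.ne' K, evalP_termP tab m 1 hypos.ne' K, evalP_termP tab m 2 hypos.ne' K,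
      evalP_termP tab m 3 hypos.ne' K] at hN
    have hsum : plocSum (pot K tab y) y m =
        (if Allowed m 0 then swt y 0 * pot K tab y (shift m 0) else 0) +
        (if Allowed m 1 then swt y 1 * pot K tab y (shift m 1) else 0) +
        (if Allowed m 2 then swt y 2 * pot K tab y (shift m 2) else 0) +
        (if Allowed m 3 then swt y 3 * pot K tab y (shift m 3) else 0) := by
      rw [plocSum, Fin.sum_univ_four]
    have hTm : evalP (tab m) y = pot K tab y m * y ^ K := by
      unfold pot; field_simp
    rw [hTm] at hN
    have hev : evalP [0, 1] y = y := by simp [evalP]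
    rw [hev] at hN
    rw [hsum]
    have hpos : 0 < y ^ K * y ^ E * y := by positivity
    rw [div_mul_eq_mul_div, le_div_iff₀ (pow_pos hypos E)]
    nlinarith [hN, hpos, pow_pos hypos K, pow_pos hypos E]

/-- **From a passing fast certificate to the free energy** (as `pulledFreeEnergy_le_log_of_certOK`). [cite: Beaton2015, Theorem 1] [cite: MadrasSlade1993, §1.2, eq. (1.2.12)–(1.2.14)] -/
theorem pulledFreeEnergy_le_log_of_certOKFast {M K E y0 : ℕ} {tab : List Step → List ℤ} {lamP : List ℤ}
    (h : certOKFast M E y0 tab lamP = true) (hy0 : 1 ≤ y0) {y : ℝ} (hy : (y0 : ℝ) ≤ y) :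
    max (Real.log (connectiveConstant 2)) (pulledBridgeFreeEnergy 2 y) ≤ Real.log (evalP lamP y / y ^ E) ∧
      ∀ n : ℕ, pulledU 2 n y ≤ (evalP lamP y / y ^ E) ^ n * evalP (tab (List.replicate M 0)) y := by
  have hy1 : (1 : ℝ) ≤ y := le_trans (by exact_mod_cast hy0) hy
  have hypos : 0 < y := by linarith
  obtain ⟨hlam, hfloor, hloc⟩ := bounds_of_certOKFast (K := K) h hy0 hy
  have hΛ : 0 < evalP lamP y / y ^ E := div_pos (by linarith) (pow_pos hypos E)
  have hδ : (0 : ℝ) < 1 / y ^ K := by positivity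
  refine ⟨pulledFreeEnergy_le_log_of_potential M (pot K tab y) hypos hΛ hδ hfloor hloc, fun n => ?_⟩
  have := pulledU_le_of_potential M (pot K tab y) hypos hΛ.le hδ hfloor hloc n
  rw [pot] at this
  convert this using 1
  field_simp

/-! ### A faster Kraft checker: the powers of `P` computed once, distinctness by sortedness

`kraftOK` recomputes `P^{N−|s|}` for every word and decides `Nodup` pairwise (quadratic); for families of `10⁴` words both are too
slow in the interpreter. Below: the powers are computed once, and the family must be listed in strictly increasing order of the key
(length, little-endian base-4 value), checked on adjacent pairs — which implies `Nodup`. -/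

/-- The powers `P⁰, …, P^N` as a list. [folklore] -/
def powsP (P : List ℤ) (N : ℕ) : List (List ℤ) := (List.range (N + 1)).map (powP P)

/-- Entries of `powsP`. [folklore] -/
private theorem powsP_getD (P : List ℤ) {N k : ℕ} (hk : k ≤ N) : (powsP P N).getD k [] = powP P k := by
  rw [powsP, List.getD_eq_getElem?_getD, List.getElem?_map, List.getElem?_range (by omega)]
  rfl

/-- The Kraft polynomial with precomputed powers. [cite: Kesten1963SAW, §4] -/
def kraftSumPFast (a N : ℕ) (pw : List (List ℤ)) : List (List Step) → List ℤ
  | [] => []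
  | s :: fam => addP (powXP (a * s.length + (xEnd s).toNat) (pw.getD (N - s.length) [])) (kraftSumPFast a N pw fam)

/-- `kraftSumPFast` with the true powers is `kraftSumP`. [folklore] -/
private theorem kraftSumPFast_eq (a N : ℕ) (P : List ℤ) : ∀ fam : List (List Step),
    kraftSumPFast a N (powsP P N) fam = kraftSumP a N P fam
  | [] => rfl
  | s :: fam => by
    rw [kraftSumPFast, kraftSumP, kraftSumPFast_eq a N P fam, powsP_getD P (Nat.sub_le N s.length)]

/-- Little-endian base-4 value of a word. [folklore] -/
def wnum : List Step → ℕ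
  | [] => 0
  | s :: w => (s : ℕ) + 4 * wnum w

/-- Words of equal length with equal value are equal. [folklore] -/
private theorem wnum_inj : ∀ {a b : List Step}, a.length = b.length → wnum a = wnum b → a = b
  | [], [], _, _ => rfl
  | [], _ :: _, h, _ => by simp at h
  | _ :: _, [], h, _ => by simp at h
  | s :: a, t :: b, hl, hv => by
    simp only [wnum] at hv
    have hs : (s : ℕ) < 4 := s.isLt
    have ht : (t : ℕ) < 4 := t.isLt
    have h1 : (s : ℕ) = t := by omega
    have h2 : wnum a = wnum b := by omega
    rw [Fin.ext h1, wnum_inj (by simpa using hl) h2]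

/-- Strict order on words by (length, value). [folklore] -/
def keyLt (a b : List Step) : Bool :=
  decide (a.length < b.length) || (decide (a.length = b.length) && decide (wnum a < wnum b))

/-- `keyLt` is transitive. [folklore] -/
private theorem keyLt_trans {a b c : List Step} (h1 : keyLt a b = true) (h2 : keyLt b c = true) : keyLt a c = true := by
  simp only [keyLt, Bool.or_eq_true, Bool.and_eq_true, decide_eq_true_eq] at h1 h2 ⊢
  omega

/-- `keyLt a b` excludes `a = b`. [folklore] -/
private theorem ne_of_keyLt {a b : List Step} (h : keyLt a b = true) : a ≠ b := by
  rintro rfl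
  simp [keyLt] at h

/-- Adjacent words strictly increase. [folklore] -/
def sortedB : List (List Step) → Bool
  | a :: b :: l => keyLt a b && sortedB (b :: l)
  | _ => true

/-- Tail and head bounds of a strictly increasing list. [folklore] -/
private theorem sortedB_cons {a : List Step} {l : List (List Step)} (h : sortedB (a :: l) = true) :
    sortedB l = true ∧ ∀ b ∈ l, keyLt a b = true := by
  induction l generalizing a with
  | nil => simp [sortedB]
  | cons b l ih =>
    simp only [sortedB, Bool.and_eq_true] at h
    obtain ⟨hab, hbl⟩ := h
    refine ⟨hbl, fun c hc => ?_⟩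
    rcases List.mem_cons.1 hc with rfl | hc
    · exact hab
    · exact keyLt_trans hab ((ih hbl).2 c hc)

/-- A strictly increasing list has no repetition. [folklore] -/
private theorem nodup_of_sortedB : ∀ {l : List (List Step)}, sortedB l = true → l.Nodup
  | [], _ => List.nodup_nil
  | a :: l, h => by
    obtain ⟨hl, hall⟩ := sortedB_cons h
    exact List.nodup_cons.2 ⟨fun ha => ne_of_keyLt (hall a ha) rfl, nodup_of_sortedB hl⟩

/-- **The fast Kraft certificate checker**: as `kraftOK`, with the powers of `P` computed once and distinctness certified by strict
sortedness of the (length, value) keys. [cite: Kesten1963SAW, §4] -/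
def kraftOKFast (a N y0 : ℕ) (fam : List (List Step)) (P : List ℤ) : Bool :=
  (fam.all fun s => decide (IrrCert s)) && decide ([(0 : Step)] ∈ fam) && sortedB fam &&
    (fam.all fun s => decide (s.length ≤ N)) && geCert y0 (subP P [1]) &&
      geCert y0 (subP (kraftSumPFast a N (powsP P N) fam) (powP P N))

/-- A passing fast certificate gives a passing `kraftOK`. [folklore] -/
private theorem kraftOK_of_kraftOKFast {a N y0 : ℕ} {fam : List (List Step)} {P : List ℤ}
    (h : kraftOKFast a N y0 fam P = true) : kraftOK a N y0 fam P = true := by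
  simp only [kraftOKFast, Bool.and_eq_true] at h
  obtain ⟨⟨⟨⟨⟨hirr, hE⟩, hsort⟩, hlen⟩, hP1⟩, hK⟩ := h
  simp only [kraftOK, Bool.and_eq_true, decide_eq_true_eq]
  refine ⟨⟨⟨⟨⟨hirr, by simpa using hE⟩, nodup_of_sortedB hsort⟩, hlen⟩, hP1⟩, ?_⟩
  rwa [kraftSumPFast_eq] at hK

/-- **From a passing fast Kraft certificate to the free energy** (as `log_le_pulledBridgeFreeEnergy_of_kraftOK`). [cite: Beaton2015, Lemma 2] [cite: Kesten1963SAW, §4] -/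
theorem log_le_pulledBridgeFreeEnergy_of_kraftOKFast {a N y0 : ℕ} {fam : List (List Step)} {P : List ℤ}
    (h : kraftOKFast a N y0 fam P = true) (hy0 : 1 ≤ y0) {y : ℝ} (hy : (y0 : ℝ) ≤ y) :
    Real.log (evalP P y / y ^ a) ≤ pulledBridgeFreeEnergy 2 y :=
  log_le_pulledBridgeFreeEnergy_of_kraftOK (kraftOK_of_kraftOKFast h) hy0 hy

/-- An `Array`-backed table lookup by window code (O(1) per window; for the large tables). [folklore] -/
def arrayTable (M : ℕ) (pots : List (List ℤ)) (idx : List (ℕ × ℕ)) (dflt : List ℤ) : Array (List ℤ) :=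
  idx.foldl (fun a ci => a.set! ci.1 (pots.getD ci.2 [1])) (Array.replicate (4 ^ M) dflt)

end Cert

end PullMem

end Literature.Probability.RandomPlanarGeometry.SAW.Zd
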